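import Summits.BirchSwinnertonDyer.BirchSwinnertonDyer.Statement
import Literature.NumberTheory.EllipticCurves.BSDSelmerCMPConverseRankOneProofs
import Literature.NumberTheory.EllipticCurves.BSDSelmerPConverseRankZeroProofs
import Literature.NumberTheory.EllipticCurves.BSDLowerBoundLayersProofs
import HarnessLib.Audit.Tags

/-!
# Solo (blind) — the low-rank cells of the summit ARE finiteness of `Ш` in algebraic rank `≤ 1`

Third kernel-checked reduction of the soloist programme `solo-BirchSwinnertonDyer-blind`
(companions: `SoloBlindCellDecomposition`, `SoloBlindPAdicSqueeze`).  Write `a = analyticRank`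
(`ord_{s=1} L(E,s)`) and `r = mordellWeilRank` (`rank E(ℚ)`); the summit `BirchSwinnertonDyer` is
`∀ E/ℚ, a = r`.  `SoloBlindCellDecomposition.bsd_iff_cells` cut it, using Gross–Zagier–Kolyvagin,
into the cells `r = 0 ⟹ a = 0`, `r = 1 ⟹ a = 1` and the deep cell `r ≥ 2 ∧ a ≥ 2 ⟹ a = r`.

This file identifies the two low cells with a purely ALGEBRAIC statement — over six named,
published theorems and nothing else:

  `bsd_iff_shaFiniteLowRank_and_deep :
     BirchSwinnertonDyer ↔ ShaFiniteLowRank ∧ (∀ E, 2 ≤ r → 2 ≤ a → a = r)`,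

where `ShaFiniteLowRank := ∀ E/ℚ, rank E(ℚ) ≤ 1 → Ш(E/ℚ) finite` (the Tate–Shafarevich conjecture
restricted to algebraic rank `≤ 1`; tagged `@[conjecture]`).  In words: **modulo published
theorems, the rank part of BSD for curves of algebraic rank `≤ 1` is exactly the finiteness of
`Ш` for those curves, and nothing analytic remains there; everything analytic that is open sits in
the regime `a ≥ 2 ∧ r ≥ 2`.**

The six facts (all hypotheses BY NAME, all theorems in print):
* `hGZK : rank_eq_analyticRank_of_analyticRank_le_one` — Gross–Zagier 1986 + Kolyvagin 1990
  (+ BFH/MM, modularity): `a ≤ 1 ⟹ r = a ∧ Ш finite` [Darmon 2004, Thm. 3.22];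
* `hKim : kim_analyticRank_eq_one_of_mordellWeilRank_eq_one` — C.-H. Kim, Math. Ann. 387 (2022),
  Cor. 1.4 (non-CM rank-one `p`-converse at one good ordinary `p > 3` with `E[p]` irreducible);
* `hBT : burungaleTian_analyticRank_eq_one_of_selmerCorank_eq_one_of_hasCM` — Burungale–Tian,
  Invent. Math. 220 (2020), Thm. 1.2 (CM rank-one `p`-converse);
* `hmod : exists_isNewformOf` — modularity (Breuil–Conrad–Diamond–Taylor 2001, Thm. A);
* `hMC : burungale_castella_skinner_charIdeal_eq_padicLFunction` — Mazur's main conjecture in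
  `Λ ⊗ ℚ_p` for every `E/ℚ`, `p ≥ 5` good ordinary, `E[p]` irreducible (Burungale–Castella–Skinner,
  IMRN 2025 = arXiv:2405.00270, Thm. 1.1.2 (a); Kato, Skinner–Urban, Wan);
* `hS : Schneider1985_order_charGenerator` — Perrin-Riou/Schneider, order and leading term of
  `f_E` at `T = 0` (Balakrishnan–Müller–Stein, Math. Comp. 85 (2016), Thm. 1.7; rank `0`:
  Greenberg LNM 1716, Thm. 4.1).
The auxiliary prime (a good ordinary `p ≥ 5` with `E[p]` irreducible on a global minimal model)
is a THEOREM of the tree (`exists_gt_mem_goodOrdinaryPrimes_hasIrreducibleModPGaloisRep`: Serre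
1981 §8 by an elementary splitting argument, *AEC* IX.6.3), as are the global minimal model
(Néron) and the invariance of `r`, `a`, `Ш` under admissible changes of variables.

The rank-one half `r = 1 ∧ Ш finite ↔ a = 1` is the tree theorem
`mordellWeilRank_eq_one_and_finite_sha_iff_analyticRank_eq_one` (Kim's diagram (1.1)); the
rank-zero half `r = 0 ∧ Ш finite ⟹ a = 0` is assembled here
(tree theorem `analyticRank_eq_zero_of_rank_eq_zero_of_finite_sha`, landed p174362) from the tree's good-ordinary
rank-zero `p`-converse `analyticRank_eq_zero_of_selmerCorank_eq_zero_of_mainConjecture`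
(Greenberg, LNM 1716, §1 p. 65–66; Burungale–Castella–Skinner, proof of Cor. 1.3.1).

Only `Ш[p^∞]` finite at ONE suitable prime is really used (`…_of_finite_sha_primary` forms), so
the sharper equivalent of the low cells is: every `E/ℚ` of rank `≤ 1` has SOME good ordinary
`p ≥ 5` with `E[p]` irreducible at which `Ш(E)[p^∞]` is finite — recorded as
`bsdLowRank_of_shaPrimaryFinite`.
-/

set_option linter.dupNamespace false

open scoped Classical
open Literature.NumberTheory.EllipticCurves Literature.NumberTheory.EllipticCurves.ModularForms
  WeierstrassCurve

namespace Summit.BirchSwinnertonDyer.BirchSwinnertonDyer.Theorems.SoloBlind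

/-- **Finiteness of `Ш` in algebraic rank `≤ 1`** (the Tate–Shafarevich conjecture, Cassels 1962 /
Tate 1974, restricted to curves with `rank E(ℚ) ≤ 1`; OPEN — known only when `ord_{s=1} L ≤ 1`,
by Kolyvagin). [cite: Wiles2000, §1 ("Tate–Shafarevich group … conjectured to be finite")] -/
@[conjecture] def ShaFiniteLowRank : Prop :=
  ∀ W : WeierstrassCurve ℚ, W.IsElliptic → W.mordellWeilRank ≤ 1 → Finite W.sha

section Facts


/-! ### Rank zero: `r = 0 ∧ Ш[p^∞] finite at one good ordinary irreducible `p ≥ 5` ⟹ `a = 0` -/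

/-- **Rank-zero `p`-converse, corank form, on a global minimal model**: `rank E(ℚ) = 0` and
`Ш(E)[p^∞]` finite at a good ordinary `p ≥ 5` with `E[p]` irreducible give `ord_{s=1} L(E,s) = 0`
(corank identity `corank Sel_{p^∞} = r + corank Ш[p^∞]`, then the tree's
`analyticRank_eq_zero_of_selmerCorank_eq_zero_of_mainConjecture`: main conjecture + Schneider's
`f_E(0) ≠ 0` + interpolation). [cite: GreenbergLNM1716, §1 pp. 65–66 and Thm. 4.1]
[cite: BurungaleCastellaSkinner2025, Thm. 1.1.2 (a) and proof of Cor. 1.3.1] -/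
theorem analyticRank_eq_zero_of_mordellWeilRank_eq_zero_of_finite_sha_primary
    (hmod : exists_isNewformOf)
    (hMC : burungale_castella_skinner_charIdeal_eq_padicLFunction)
    (hS : Schneider1985_order_charGenerator)
    (W : WeierstrassCurve ℚ) [W.IsElliptic] [W.IsGloballyMinimal] (p : ℕ) [Fact p.Prime]
    (hp : 5 ≤ p) (hgood : W.HasGoodReductionAtPrime p) (hord : ¬ (p : ℤ) ∣ W.frobeniusTrace p)
    (hirr : W.HasIrreducibleModPGaloisRep p) (hrank : W.mordellWeilRank = 0)
    (hsha : Finite (AddCommGroup.primaryComponent W.sha p)) : W.analyticRank = 0 := by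
  have hcorank : W.selmerCorank p = 0 := by
    rw [W.selmerCorank_eq_mordellWeilRank_add_holds p, hrank, zero_add]
    exact (finite_primaryComponent_sha_iff_shaCorank_eq_zero W p).1 hsha
  exact analyticRank_eq_zero_of_selmerCorank_eq_zero_of_mainConjecture hmod hMC hS W p hp hgood hord
    hirr hcorank

-- `analyticRank_eq_zero_of_rank_eq_zero_of_finite_sha` (every `E/ℚ`: rank 0 ∧ Ш finite ⟹ a = 0) is the
-- landed tree theorem `Literature.NumberTheory.EllipticCurves.analyticRank_eq_zero_of_rank_eq_zero_of_finite_sha`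
-- (BSDLowerBoundLayersProofs, p174362) and is used below by name.

/-- `rank E(ℚ) = 0 ∧ Ш(E) finite ⟺ ord_{s=1} L(E,s) = 0`, for every `E/ℚ` (the rank-zero row of
Kim's diagram (1.1)), from the rank-zero `p`-converse and Gross–Zagier–Kolyvagin.
[cite: GreenbergLNM1716, §1 pp. 65–66] [cite: Darmon2004, Thm. 3.22] -/
theorem mordellWeilRank_eq_zero_and_finite_sha_iff_analyticRank_eq_zero
    (hGZK : rank_eq_analyticRank_of_analyticRank_le_one)
    (hmod : exists_isNewformOf)
    (hMC : burungale_castella_skinner_charIdeal_eq_padicLFunction)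
    (hS : Schneider1985_order_charGenerator)
    (W : WeierstrassCurve ℚ) [W.IsElliptic] :
    (W.mordellWeilRank = 0 ∧ Finite W.sha) ↔ W.analyticRank = 0 := by
  refine ⟨fun h => analyticRank_eq_zero_of_rank_eq_zero_of_finite_sha hmod hMC hS W h.1 h.2,
    fun h => ?_⟩
  obtain ⟨hrank, hsha⟩ := hGZK W (by omega)
  exact ⟨by rw [hrank, h], hsha⟩

/-! ### The summit: low cells = `Ш` finite in rank `≤ 1`; the rest is the deep cell -/

/-- **`BirchSwinnertonDyer ↔ ShaFiniteLowRank ∧ DeepCell`.** Modulo Gross–Zagier–Kolyvagin, the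
rank-one `p`-converse (Kim; Burungale–Tian for CM), modularity, Mazur's main conjecture
(Burungale–Castella–Skinner) and Perrin-Riou–Schneider, the rank conjecture is equivalent to:
(i) `Ш(E/ℚ)` is finite for every `E/ℚ` of algebraic rank `≤ 1`, and (ii) `ord_{s=1} L = rank`
for every `E/ℚ` with `rank ≥ 2` and `ord_{s=1} L ≥ 2`.
[cite: Kim2022, §1 diagram (1.1) and Cor. 1.4] [cite: Darmon2004, Thm. 3.22]
[cite: BurungaleCastellaSkinner2025, Thm. 1.1.2 (a)] -/
theorem bsd_iff_shaFiniteLowRank_and_deep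
    (hGZK : rank_eq_analyticRank_of_analyticRank_le_one)
    (hKim : kim_analyticRank_eq_one_of_mordellWeilRank_eq_one)
    (hBT : burungaleTian_analyticRank_eq_one_of_selmerCorank_eq_one_of_hasCM)
    (hmod : exists_isNewformOf)
    (hMC : burungale_castella_skinner_charIdeal_eq_padicLFunction)
    (hS : Schneider1985_order_charGenerator)
    :
    _root_.BirchSwinnertonDyer ↔
      ShaFiniteLowRank ∧
        (∀ W : WeierstrassCurve ℚ, W.IsElliptic → 2 ≤ W.mordellWeilRank → 2 ≤ W.analyticRank →
          W.analyticRank = W.mordellWeilRank) := by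
  constructor
  · intro hbsd
    refine ⟨fun W hE hr => ?_, fun W hE _ _ => hbsd W hE⟩
    have ha : W.analyticRank ≤ 1 := by rw [hbsd W hE]; exact hr
    exact (hGZK W ha).2
  · rintro ⟨hsha, hdeep⟩ W hE
    rcases Nat.lt_or_ge W.mordellWeilRank 2 with hr | hr
    · haveI : Finite W.sha := hsha W hE (by omega)
      rcases Nat.lt_or_ge W.mordellWeilRank 1 with hr0 | hr1
      · have h0 : W.mordellWeilRank = 0 := by omega
        rw [h0, analyticRank_eq_zero_of_rank_eq_zero_of_finite_sha hmod hMC hS W h0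
          inferInstance]
      · have h1 : W.mordellWeilRank = 1 := by omega
        rw [h1, analyticRank_eq_one_of_mordellWeilRank_eq_one_of_finite_sha hKim hBT W h1 inferInstance]
    · by_cases ha : W.analyticRank ≤ 1
      · exact absurd ((hGZK W ha).1) (by omega)
      · exact hdeep W hE hr (by omega)

/-- **Corollary: the rank conjecture for curves of algebraic rank `≤ 1` is exactly `Ш`-finiteness
there.** [cite: Kim2022, §1 diagram (1.1)] [cite: Darmon2004, Thm. 3.22] -/
theorem bsdLowRank_iff_shaFiniteLowRank
    (hGZK : rank_eq_analyticRank_of_analyticRank_le_one)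
    (hKim : kim_analyticRank_eq_one_of_mordellWeilRank_eq_one)
    (hBT : burungaleTian_analyticRank_eq_one_of_selmerCorank_eq_one_of_hasCM)
    (hmod : exists_isNewformOf)
    (hMC : burungale_castella_skinner_charIdeal_eq_padicLFunction)
    (hS : Schneider1985_order_charGenerator)
    :
    (∀ W : WeierstrassCurve ℚ, W.IsElliptic → W.mordellWeilRank ≤ 1 →
        W.analyticRank = W.mordellWeilRank) ↔ ShaFiniteLowRank := by
  constructor
  · intro h W hE hr
    have ha : W.analyticRank ≤ 1 := by rw [h W hE hr]; exact hr
    exact (hGZK W ha).2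
  · intro hsha W hE hr
    haveI : Finite W.sha := hsha W hE hr
    rcases Nat.lt_or_ge W.mordellWeilRank 1 with hr0 | hr1
    · have h0 : W.mordellWeilRank = 0 := by omega
      rw [h0, analyticRank_eq_zero_of_rank_eq_zero_of_finite_sha hmod hMC hS W h0
        inferInstance]
    · have h1 : W.mordellWeilRank = 1 := by omega
      rw [h1, analyticRank_eq_one_of_mordellWeilRank_eq_one_of_finite_sha hKim hBT W h1 inferInstance]

/-- **The sharp low-rank input: `Ш[p^∞]` finite at ONE auxiliary prime.** On a globally minimal
model: if `rank E(ℚ) ≤ 1` and `Ш(E)[p^∞]` is finite for some good ordinary `p ≥ 5` with `E[p]`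
irreducible, then `ord_{s=1} L(E,s) = rank E(ℚ)` (CM or not).
[cite: Kim2022, Cor. 1.4] [cite: GreenbergLNM1716, §1 pp. 65–66] -/
theorem bsdLowRank_of_shaPrimaryFinite
    (hKim : kim_analyticRank_eq_one_of_mordellWeilRank_eq_one)
    (hBT : burungaleTian_analyticRank_eq_one_of_selmerCorank_eq_one_of_hasCM)
    (hmod : exists_isNewformOf)
    (hMC : burungale_castella_skinner_charIdeal_eq_padicLFunction)
    (hS : Schneider1985_order_charGenerator)
    (W : WeierstrassCurve ℚ) [W.IsElliptic] [W.IsGloballyMinimal]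
    (p : ℕ) [Fact p.Prime] (hp : 5 ≤ p) (hgood : W.HasGoodReductionAtPrime p)
    (hord : ¬ (p : ℤ) ∣ W.frobeniusTrace p) (hirr : W.HasIrreducibleModPGaloisRep p)
    (hr : W.mordellWeilRank ≤ 1)
    (hsha : Finite (AddCommGroup.primaryComponent W.sha p)) :
    W.analyticRank = W.mordellWeilRank := by
  rcases Nat.lt_or_ge W.mordellWeilRank 1 with hr0 | hr1
  · have h0 : W.mordellWeilRank = 0 := by omega
    rw [h0, analyticRank_eq_zero_of_mordellWeilRank_eq_zero_of_finite_sha_primary hmod hMC hS W p hp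
      hgood hord hirr h0 hsha]
  · have h1 : W.mordellWeilRank = 1 := by omega
    rw [h1]
    exact analyticRank_eq_one_of_mordellWeilRank_eq_one_of_finite_sha_primary hKim hBT W p
      (by omega) hgood hord (fun _ => hirr) h1 hsha

end Facts

end Summit.BirchSwinnertonDyer.BirchSwinnertonDyer.Theorems.SoloBlind
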